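import Summits.CriticalPhenomena.PercolationContinuityZ3.Theorems.PercNearOneGluingNoHeavyPcintChordRandPairs
import Summits.CriticalPhenomena.PercolationContinuityZ3.Theorems.PercNearOneGluingNoHeavyPcintNawRandReduction
import Literature.Probability.Percolation.FiniteEnergy
import HarnessLib

/-!
# PCINT lane, reduction B3r: `θ(p) ≤ Σ_{γ SAW} pⁿ (1-p)^{#chords} s^{gapTotal γ} ((1+s)/2)^{cornerTotal γ}`

Cell `prim-pcint`, seat `prim-pcint-2`; memo `run/shared/lean/prim/pcint/REDUCTIONS.md` §B3+, §B3r, §B3r.6.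
Does NOT build on p205010.

BOND percolation on `ℤ^d`.  For every family `o` of sibling orders, the code-least open geodesic word `γ`
realises the event `chordRandEvent o γ`: its edges open, its chords closed, and for every charged site `w`
and every SELECTED pair `(i, j)` of incidence times (`…PcintChordRandPairs`) the edges `{v_i, w}`, `{w, v_j}`
not both open.  These events are determined by pairwise disjoint finite edge sets, so (product measure,
`bondPercolation_real_inter_of_disjoint`) `P = pⁿ (1-p)^{#chords} ∏ (1 - p²)`, and with `2·#selected ≥
#charged` per site and `s² ≥ 1 - p²`: `P ≤ pⁿ (1-p)^{#chords} s^{gapTotal} s^{#bad corners}`.  Averaging over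
`o` exactly as in B2r (`sum_orders_pow_card_badTimes`) gives the reduction of certificate kind `chordrand_cw`
in FULL-INFORMATION form (`theta_le_sum_chordRandWeight`); the engines' causal window automata dominate this
weight by the booking argument of REDUCTIONS §B3r.2 (β'), not formalised here (§B3r.6).
-/

noncomputable section

namespace Summit.CriticalPhenomena.PercolationContinuityZ3.Theorems.Pcint

open Finset MeasureTheory Literature.Probability.Percolation Literature.Probability.LatticeModels

variable {d n : ℕ}

/-! ### The event of a word -/

/-- All selected (site, pair of times) of a word under `o`. [folklore] -/
def allSel (o : Orders d n) (γ : Fin n → Fin d × Bool) : Finset (Σ _ : Site d, ℕ × ℕ) :=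
  (forcedSites o γ).sigma fun w => selPairs γ w

/-- The two edges `{v_i, w}`, `{w, v_j}` of a selected pair. [folklore] -/
def pairEdges (γ : Fin n → Fin d × Bool) (q : Σ _ : Site d, ℕ × ℕ) : Finset (Sym2 (Site d)) :=
  {s(wordPos γ q.2.1, q.1), s(q.1, wordPos γ q.2.2)}

/-- The event "the two edges of the pair are not both open". [folklore] -/
def pairEvt (γ : Fin n → Fin d × Bool) (q : Σ _ : Site d, ℕ × ℕ) : Set (BondConfig (Site d)) :=
  {ω | ¬ (s(wordPos γ q.2.1, q.1) ∈ ω ∧ s(q.1, wordPos γ q.2.2) ∈ ω)}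

/-- The base event "edges of `γ` open, chords of `γ` closed". [folklore] -/
def baseEvt (γ : Fin n → Fin d × Bool) : Set (BondConfig (Site d)) :=
  {ω | (↑(wordEdges γ) : Set (Sym2 (Site d))) ⊆ ω ∧ Disjoint (↑(chordEdges γ) : Set (Sym2 (Site d))) ω}

/-- The B3r event of a word under `o`. [folklore] -/
def chordRandEvent (o : Orders d n) (γ : Fin n → Fin d × Bool) : Set (BondConfig (Site d)) :=
  baseEvt γ ∩ ⋂ q ∈ allSel o γ, pairEvt γ q

/-- Membership in `allSel`. [folklore] -/
theorem mem_allSel {o : Orders d n} {γ : Fin n → Fin d × Bool} {q : Σ _ : Site d, ℕ × ℕ} :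
    q ∈ allSel o γ ↔ q.1 ∈ forcedSites o γ ∧ q.2 ∈ selPairs γ q.1 := by
  rw [allSel, mem_sigma]

/-- **Forcing (bond).** The code-least open geodesic word realises its event. [folklore] -/
theorem mem_chordRandEvent_of_minimal {ω : BondConfig (Site d)} (hω : ω ⊆ (zdGraph d).edgeSet)
    {o : Orders d n} {γ : Fin n → Fin d × Bool} (hγ : γ ∈ bgeoWords ω n)
    (hmin : ∀ γ' ∈ bgeoWords ω n, code o γ ≤ code o γ') : ω ∈ chordRandEvent o γ := by
  refine ⟨⟨(mem_bgeoWords.1 hγ).1, Set.disjoint_left.2 fun e he heω =>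
    chord_not_mem_of_mem_bgeoWords hγ (mem_coe.1 he) heω⟩, ?_⟩
  simp only [Set.mem_iInter]
  intro q hq
  obtain ⟨hw, hij⟩ := mem_allSel.1 hq
  exact not_pairOpen_of_mem_selPairs hω hγ hmin hw hij

/-- **Covering.** `{0 ↔ ∞} ⊆ ⋃_{γ SAW} chordRandEvent o γ ∪ {ω ⊄ E(𝕃^d)}`. [folklore] -/
theorem percolatesAt_subset_biUnion_chordRandEvent (o : Orders d n) :
    (percolatesAt (0 : Site d) : Set (BondConfig (Site d))) ⊆
      (⋃ γ ∈ sawWords d n, chordRandEvent o γ) ∪ {ω | ¬ ω ⊆ (zdGraph d).edgeSet} := by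
  intro ω hω
  by_cases hb : ω ⊆ (zdGraph d).edgeSet
  · obtain ⟨γ, hγ, hmin⟩ := exists_minimal_bgeoWord hb hω o
    exact Or.inl (Set.mem_biUnion (mem_coe.2 (mem_sawWords_of_mem_bgeoWords hγ))
      (mem_chordRandEvent_of_minimal hb hγ hmin))
  · exact Or.inr hb

/-! ### Finite dependence of the events -/

/-- The base event is determined by the edges and chords of the word. [folklore] -/
theorem determinedBy_baseEvt (γ : Fin n → Fin d × Bool) :
    DeterminedBy (baseEvt γ) (↑(wordEdges γ ∪ chordEdges γ) : Set (Sym2 (Site d))) := by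
  rw [determinedBy_iff]
  intro ω ω' h
  rw [coe_union] at h
  simp only [baseEvt, Set.mem_setOf_eq]
  have key : ∀ e ∈ (↑(wordEdges γ) : Set (Sym2 (Site d))) ∪ ↑(chordEdges γ), e ∈ ω ↔ e ∈ ω' := by
    intro e he
    constructor
    · intro heω; have : e ∈ ω ∩ (↑(wordEdges γ) ∪ ↑(chordEdges γ)) := ⟨heω, he⟩; rw [h] at this; exact this.1
    · intro heω; have : e ∈ ω' ∩ (↑(wordEdges γ) ∪ ↑(chordEdges γ)) := ⟨heω, he⟩; rw [← h] at this; exact this.1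
  constructor
  · rintro ⟨h1, h2⟩
    refine ⟨fun e he => (key e (Or.inl he)).1 (h1 he), Set.disjoint_left.2 fun e he heω => ?_⟩
    exact Set.disjoint_left.1 h2 he ((key e (Or.inr he)).2 heω)
  · rintro ⟨h1, h2⟩
    refine ⟨fun e he => (key e (Or.inl he)).2 (h1 he), Set.disjoint_left.2 fun e he heω => ?_⟩
    exact Set.disjoint_left.1 h2 he ((key e (Or.inr he)).1 heω)

/-- A pair event is determined by its two edges. [folklore] -/
theorem determinedBy_pairEvt (γ : Fin n → Fin d × Bool) (q : Σ _ : Site d, ℕ × ℕ) :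
    DeterminedBy (pairEvt γ q) (↑(pairEdges γ q) : Set (Sym2 (Site d))) := by
  rw [determinedBy_iff]
  intro ω ω' h
  have key : ∀ e ∈ (↑(pairEdges γ q) : Set (Sym2 (Site d))), e ∈ ω ↔ e ∈ ω' := by
    intro e he
    constructor
    · intro heω; have : e ∈ ω ∩ ↑(pairEdges γ q) := ⟨heω, he⟩; rw [h] at this; exact this.1
    · intro heω; have : e ∈ ω' ∩ ↑(pairEdges γ q) := ⟨heω, he⟩; rw [← h] at this; exact this.1
  have k1 := key _ (mem_coe.2 (by simp [pairEdges] : s(wordPos γ q.2.1, q.1) ∈ pairEdges γ q))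
  have k2 := key _ (mem_coe.2 (by simp [pairEdges] : s(q.1, wordPos γ q.2.2) ∈ pairEdges γ q))
  simp only [pairEvt, Set.mem_setOf_eq, k1, k2]

/-- A finite intersection of finitely determined events is determined by the union of the index sets.
[folklore] -/
theorem DeterminedBy.biInter_finset {ι E : Type*} {s : Finset ι} {A : ι → Set (Set E)} {K : ι → Finset E}
    [DecidableEq E] (h : ∀ i ∈ s, DeterminedBy (A i) (↑(K i) : Set E)) :
    DeterminedBy (⋂ i ∈ s, A i) (↑(s.biUnion K) : Set E) := by
  rw [determinedBy_iff]
  intro ω ω' hω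
  simp only [Set.mem_iInter]
  refine forall₂_congr fun i hi => ?_
  have hKi : (↑(K i) : Set E) ⊆ ↑(s.biUnion K) := coe_subset.2 (subset_biUnion_of_mem K hi)
  have hωi : ω ∩ ↑(K i) = ω' ∩ ↑(K i) := by
    rw [← Set.inter_eq_self_of_subset_right hKi, ← Set.inter_assoc, hω, Set.inter_assoc]
  exact (determinedBy_iff _ _).1 (h i hi) ω ω' hωi

/-- **Independence product.** Events determined by pairwise disjoint finite edge sets multiply under
`P_p`. [folklore] -/
theorem bondPercolation_real_biInter_eq_prod {ι : Type*} [DecidableEq ι] (p : unitInterval) (s : Finset ι)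
    (A : ι → Set (BondConfig (Site d))) (K : ι → Finset (Sym2 (Site d)))
    (hA : ∀ i ∈ s, DeterminedBy (A i) (↑(K i) : Set (Sym2 (Site d))))
    (hK : ∀ i ∈ s, ∀ j ∈ s, i ≠ j → Disjoint (K i) (K j)) :
    (bondPercolation (zdGraph d) p).real (⋂ i ∈ s, A i) =
      ∏ i ∈ s, (bondPercolation (zdGraph d) p).real (A i) := by
  classical
  induction s using Finset.induction_on with
  | empty => simp
  | insert a s ha ih =>
    have hA' : ∀ i ∈ s, DeterminedBy (A i) (↑(K i) : Set (Sym2 (Site d))) :=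
      fun i hi => hA i (mem_insert_of_mem hi)
    have hrest := DeterminedBy.biInter_finset hA'
    have hdisj : Disjoint (↑(K a) : Set (Sym2 (Site d))) ↑(s.biUnion K) := by
      rw [disjoint_coe, disjoint_biUnion_right]
      intro i hi
      exact hK a (mem_insert_self _ _) i (mem_insert_of_mem hi) (fun h => ha (h ▸ hi))
    rw [set_biInter_insert, prod_insert ha,
      bondPercolation_real_inter_of_disjoint (zdGraph d) p hdisj (hA a (mem_insert_self _ _)) hrest
        (hA a (mem_insert_self _ _)).measurableSet_of_finset hrest.measurableSet_of_finset,
      ih hA' fun i hi j hj => hK i (mem_insert_of_mem hi) j (mem_insert_of_mem hj)]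

/-! ### Disjointness of the edge sets -/

/-- An edge at an off-path site is not an edge between path sites. [folklore] -/
theorem ne_of_offPath {γ : Fin n → Fin d × Bool} {w x : Site d} (hw : w ∉ pathSites γ) {a b : ℕ}
    (ha : a ≤ n) (hb : b ≤ n) : s(x, w) ≠ s(wordPos γ a, wordPos γ b) := by
  intro h
  rw [Sym2.eq_iff] at h
  rcases h with ⟨-, h⟩ | ⟨-, h⟩
  · exact hw (mem_pathSites.2 ⟨b, hb, h.symm⟩)
  · exact hw (mem_pathSites.2 ⟨a, ha, h.symm⟩)

/-- An edge at an off-path site determines the site and the path vertex. [folklore] -/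
theorem eq_of_siteEdge_eq {γ : Fin n → Fin d × Bool} (hs : IsSAW γ) {w w' : Site d}
    (hw : w ∉ pathSites γ) {a b : ℕ} (ha : a ≤ n) (hb : b ≤ n)
    (h : s(wordPos γ a, w) = s(wordPos γ b, w')) : w = w' ∧ a = b := by
  rw [Sym2.eq_iff] at h
  rcases h with ⟨h1, h2⟩ | ⟨h1, h2⟩
  · exact ⟨h2, hs a b ha hb h1⟩
  · exact (hw (mem_pathSites.2 ⟨b, hb, h2.symm⟩)).elim

/-- The edges of a selected pair, oriented from the path. [folklore] -/
theorem mem_pairEdges {γ : Fin n → Fin d × Bool} {q : Σ _ : Site d, ℕ × ℕ} {e : Sym2 (Site d)} :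
    e ∈ pairEdges γ q ↔ e = s(wordPos γ q.2.1, q.1) ∨ e = s(wordPos γ q.2.2, q.1) := by
  rw [pairEdges, mem_insert, mem_singleton, Sym2.eq_swap (a := q.1)]

/-- Facts about a selected (site, pair). [folklore] -/
theorem allSel_spec {o : Orders d n} {γ : Fin n → Fin d × Bool} {q : Σ _ : Site d, ℕ × ℕ}
    (hq : q ∈ allSel o γ) :
    q.1 ∉ pathSites γ ∧ q.2.1 ≤ n ∧ q.2.2 ≤ n ∧ q.2.1 < q.2.2 ∧
      (zdGraph d).Adj (wordPos γ q.2.1) q.1 ∧ (zdGraph d).Adj (wordPos γ q.2.2) q.1 := by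
  obtain ⟨hw, hij⟩ := mem_allSel.1 hq
  obtain ⟨hi, hj, hlt, -, -⟩ := mem_selPairs hij
  obtain ⟨hin, hai⟩ := mem_incTimes.1 hi
  obtain ⟨hjn, haj⟩ := mem_incTimes.1 hj
  exact ⟨disjoint_right.1 (disjoint_pathSites_forcedSites o γ) hw, hin, hjn, hlt, hai, haj⟩

/-- Pair edges avoid the path edges and chords. [folklore] -/
theorem disjoint_base_pairEdges (o : Orders d n) (γ : Fin n → Fin d × Bool) :
    Disjoint (wordEdges γ ∪ chordEdges γ) ((allSel o γ).biUnion (pairEdges γ)) := by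
  rw [disjoint_right]
  intro e he heb
  rw [mem_biUnion] at he
  obtain ⟨q, hq, heq⟩ := he
  obtain ⟨hoff, hin, hjn, -, -, -⟩ := allSel_spec hq
  rw [mem_union] at heb
  have hform : ∃ x, e = s(x, q.1) := by
    rcases mem_pairEdges.1 heq with rfl | rfl
    · exact ⟨_, rfl⟩
    · exact ⟨_, rfl⟩
  obtain ⟨x, rfl⟩ := hform
  rcases heb with heb | heb
  · rw [wordEdges, mem_image] at heb
    obtain ⟨k, hk, hke⟩ := heb
    rw [mem_range] at hk
    exact ne_of_offPath hoff (by omega : k ≤ n) (by omega : k + 1 ≤ n) hke.symm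
  · obtain ⟨a, b, hab, hbn, -, hke⟩ := mem_chordEdges.1 heb
    exact ne_of_offPath hoff (by omega : a ≤ n) hbn hke

/-- Distinct selected pairs have disjoint edge pairs. [folklore] -/
theorem pairEdges_disjoint {o : Orders d n} {γ : Fin n → Fin d × Bool} (hs : IsSAW γ)
    {q q' : Σ _ : Site d, ℕ × ℕ} (hq : q ∈ allSel o γ) (hq' : q' ∈ allSel o γ) (hne : q ≠ q') :
    Disjoint (pairEdges γ q) (pairEdges γ q') := by
  obtain ⟨hoff, hin, hjn, -, -, -⟩ := allSel_spec hq
  obtain ⟨hoff', hin', hjn', -, -, -⟩ := allSel_spec hq'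
  rw [disjoint_left]
  intro e he he'
  -- any common edge forces the same site and the same time
  have key : ∀ {a b : ℕ}, a ≤ n → b ≤ n → s(wordPos γ a, q.1) = s(wordPos γ b, q'.1) → q.1 = q'.1 ∧ a = b :=
    fun ha hb h => eq_of_siteEdge_eq hs hoff ha hb h
  have hsame : q.1 = q'.1 ∧ (q.2.1 = q'.2.1 ∨ q.2.1 = q'.2.2 ∨ q.2.2 = q'.2.1 ∨ q.2.2 = q'.2.2) := by
    rcases mem_pairEdges.1 he with rfl | rfl <;> rcases mem_pairEdges.1 he' with h | h
    · obtain ⟨h1, h2⟩ := key hin hin' h; exact ⟨h1, Or.inl h2⟩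
    · obtain ⟨h1, h2⟩ := key hin hjn' h; exact ⟨h1, Or.inr (Or.inl h2)⟩
    · obtain ⟨h1, h2⟩ := key hjn hin' h; exact ⟨h1, Or.inr (Or.inr (Or.inl h2))⟩
    · obtain ⟨h1, h2⟩ := key hjn hjn' h; exact ⟨h1, Or.inr (Or.inr (Or.inr h2))⟩
  obtain ⟨hw, htimes⟩ := hsame
  obtain ⟨w, ij⟩ := q
  obtain ⟨w', ij'⟩ := q'
  simp only at hw
  subst hw
  have hij : ij ∈ selPairs γ w := (mem_allSel.1 hq).2
  have hij' : ij' ∈ selPairs γ w := (mem_allSel.1 hq').2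
  have hne' : ij ≠ ij' := fun h => hne (by rw [h])
  obtain ⟨c1, c2, c3, c4⟩ := selPairs_disjoint_coords hij hij' hne'
  simp only at htimes
  rcases htimes with h | h | h | h
  · exact c1 h
  · exact c2 h
  · exact c3 h
  · exact c4 h

/-! ### The probability of the event -/

/-- The two edges of a selected pair are distinct lattice edges. [folklore] -/
theorem pairEdges_spec {o : Orders d n} {γ : Fin n → Fin d × Bool} (hs : IsSAW γ)
    {q : Σ _ : Site d, ℕ × ℕ} (hq : q ∈ allSel o γ) :
    s(wordPos γ q.2.1, q.1) ≠ s(q.1, wordPos γ q.2.2) ∧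
      (↑(pairEdges γ q) : Set (Sym2 (Site d))) ⊆ (zdGraph d).edgeSet := by
  obtain ⟨hoff, hin, hjn, hlt, hai, haj⟩ := allSel_spec hq
  refine ⟨fun h => ?_, fun e he => ?_⟩
  · rw [Sym2.eq_swap (a := q.1)] at h
    have := (eq_of_siteEdge_eq hs hoff hin hjn h).2
    omega
  · rcases mem_pairEdges.1 (mem_coe.1 he) with rfl | rfl
    · exact (SimpleGraph.mem_edgeSet _).2 hai
    · exact (SimpleGraph.mem_edgeSet _).2 haj

/-- `P(pair not both open) = 1 - p²`. [folklore] -/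
theorem bondPercolation_real_pairEvt (p : unitInterval) {o : Orders d n} {γ : Fin n → Fin d × Bool}
    (hs : IsSAW γ) {q : Σ _ : Site d, ℕ × ℕ} (hq : q ∈ allSel o γ) :
    (bondPercolation (zdGraph d) p).real (pairEvt γ q) = 1 - (p : ℝ) ^ 2 := by
  obtain ⟨hne, hsub⟩ := pairEdges_spec hs hq
  have hset : pairEvt γ q = {ω | (↑(pairEdges γ q) : Set (Sym2 (Site d))) ⊆ ω}ᶜ := by
    ext ω
    simp only [pairEvt, pairEdges, Set.mem_setOf_eq, Set.mem_compl_iff, coe_insert, coe_singleton,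
      Set.insert_subset_iff, Set.singleton_subset_iff]
  have hmeas : MeasurableSet {ω : BondConfig (Site d) | (↑(pairEdges γ q) : Set (Sym2 (Site d))) ⊆ ω} := by
    refine DeterminedBy.measurableSet_of_finset (F := pairEdges γ q) ?_
    rw [determinedBy_iff]
    intro ω ω' h
    simp only [Set.mem_setOf_eq]
    constructor
    · intro hh e he; have : e ∈ ω ∩ ↑(pairEdges γ q) := ⟨hh he, he⟩; rw [h] at this; exact this.1
    · intro hh e he; have : e ∈ ω' ∩ ↑(pairEdges γ q) := ⟨hh he, he⟩; rw [← h] at this; exact this.1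
  rw [hset, probReal_compl_eq_one_sub hmeas, bondPercolation_real_setOf_subset _ _ _ hsub, pairEdges,
    card_pair hne]

/-- **The probability of the event**: `pⁿ (1-p)^{#chords} (1-p²)^{#allSel}`. [folklore] -/
theorem bondPercolation_real_chordRandEvent (p : unitInterval) (o : Orders d n) {γ : Fin n → Fin d × Bool}
    (hs : IsSAW γ) :
    (bondPercolation (zdGraph d) p).real (chordRandEvent o γ) =
      (p : ℝ) ^ n * (1 - p : ℝ) ^ (chordEdges γ).card * (1 - (p : ℝ) ^ 2) ^ (allSel o γ).card := by
  classical
  have hbase := determinedBy_baseEvt γ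
  have hpairs : DeterminedBy (⋂ q ∈ allSel o γ, pairEvt γ q)
      (↑((allSel o γ).biUnion (pairEdges γ)) : Set (Sym2 (Site d))) :=
    DeterminedBy.biInter_finset fun q _ => determinedBy_pairEvt γ q
  rw [chordRandEvent, bondPercolation_real_inter_of_disjoint (zdGraph d) p
      (disjoint_coe.2 (disjoint_base_pairEdges o γ)) hbase hpairs hbase.measurableSet_of_finset
      hpairs.measurableSet_of_finset,
    bondPercolation_real_biInter_eq_prod p (allSel o γ) (pairEvt γ) (pairEdges γ)
      (fun q _ => determinedBy_pairEvt γ q) (fun q hq q' hq' hne => pairEdges_disjoint hs hq hq' hne),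
    prod_congr rfl fun q hq => bondPercolation_real_pairEvt p hs hq, prod_const, baseEvt,
    bondPercolation_real_open_closed _ _ (wordEdges_subset_edgeSet γ) (chordEdges_subset_edgeSet γ)
      (IsSAW.disjoint_wordEdges_chordEdges hs), hs.card_wordEdges]

/-- **Counting**: `(1-p²)^{#allSel} ≤ s^{#charged events}` when `s² ≥ 1-p²`, `s ≤ 1`. [folklore] -/
theorem pow_card_allSel_le {o : Orders d n} {γ : Fin n → Fin d × Bool} (hγ : IsSAW γ) {r s : ℝ}
    (hr0 : 0 ≤ r) (hs0 : 0 ≤ s) (hs1 : s ≤ 1) (hrs : r ≤ s ^ 2) :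
    r ^ (allSel o γ).card ≤ s ^ (chargedPairs o γ).card := by
  rw [allSel, card_sigma, ← prod_pow_eq_pow_sum]
  calc ∏ w ∈ forcedSites o γ, r ^ (selPairs γ w).card
      ≤ ∏ w ∈ forcedSites o γ, s ^ ((chargedPairs o γ).filter fun x => x.2 = w).card :=
        prod_le_prod (fun _ _ => pow_nonneg hr0 _) fun w _ => by
          calc r ^ (selPairs γ w).card ≤ (s ^ 2) ^ (selPairs γ w).card := pow_le_pow_left₀ hr0 hrs _
            _ = s ^ (2 * (selPairs γ w).card) := by rw [pow_mul]
            _ ≤ s ^ ((chargedPairs o γ).filter fun x => x.2 = w).card :=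
                pow_le_pow_of_le_one hs0 hs1 (card_fiber_chargedPairs_le_two_mul_card_selPairs hγ w)
    _ = s ^ (chargedPairs o γ).card := by
        rw [prod_pow_eq_pow_sum, forcedSites, ← card_eq_sum_card_image]

/-! ### The reduction -/

/-- The symmetric (order-averaged) B3r weight of a word. [folklore] -/
def chordRandWeight (p s : ℝ) (γ : Fin n → Fin d × Bool) : ℝ :=
  p ^ n * (1 - p) ^ (chordEdges γ).card * s ^ gapTotal γ * ((1 + s) / 2) ^ cornerTotal γ

/-- Per family of orders: `θ(p) ≤ Σ_{γ SAW} pⁿ (1-p)^{#chords} s^{gapTotal γ} s^{#badTimes o γ}`. [folklore] -/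
theorem theta_le_sum_of_orders (p : unitInterval) (o : Orders d n) {s : ℝ} (hs0 : 0 ≤ s) (hs1 : s ≤ 1)
    (hps : 1 - (p : ℝ) ^ 2 ≤ s ^ 2) :
    theta (zdGraph d) 0 p ≤ ∑ γ ∈ sawWords d n,
      (p : ℝ) ^ n * (1 - p : ℝ) ^ (chordEdges γ).card * s ^ gapTotal γ * s ^ (badTimes o γ).card := by
  classical
  set μ := bondPercolation (zdGraph d) p with hμ
  set bad : Set (BondConfig (Site d)) := {ω | ¬ ω ⊆ (zdGraph d).edgeSet} with hbad
  have hbad0 : μ.real bad = 0 := by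
    rw [measureReal_eq_zero_iff]
    have := ProbabilityTheory.setBernoulli_ae_subset (u := (zdGraph d).edgeSet) (p := p)
    rw [Filter.Eventually, mem_ae_iff, Set.compl_setOf] at this
    exact this
  have hp2 : 0 ≤ 1 - (p : ℝ) ^ 2 := by nlinarith [p.2.1, p.2.2]
  calc theta (zdGraph d) 0 p = μ.real (percolatesAt 0) := rfl
    _ ≤ μ.real ((⋃ γ ∈ sawWords d n, chordRandEvent o γ) ∪ bad) :=
        measureReal_mono (percolatesAt_subset_biUnion_chordRandEvent o)
    _ ≤ μ.real (⋃ γ ∈ sawWords d n, chordRandEvent o γ) + μ.real bad := measureReal_union_le _ _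
    _ = μ.real (⋃ γ ∈ sawWords d n, chordRandEvent o γ) := by rw [hbad0, add_zero]
    _ ≤ ∑ γ ∈ sawWords d n, μ.real (chordRandEvent o γ) := measureReal_biUnion_finset_le _ _
    _ ≤ _ := sum_le_sum fun γ hγ => ?_
  have hsaw : IsSAW γ := mem_sawWords.1 hγ
  rw [hμ, bondPercolation_real_chordRandEvent p o hsaw, mul_assoc ((p : ℝ) ^ n * _), ← pow_add,
    ← card_chargedPairs]
  exact mul_le_mul_of_nonneg_left (pow_card_allSel_le hsaw hp2 hs0 hs1 hps)
    (mul_nonneg (pow_nonneg p.2.1 _) (pow_nonneg (sub_nonneg.2 p.2.2) _))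

/-- **Reduction B3r** (certificate kind `chordrand_cw`, full-information form).  For `0 ≤ s ≤ 1` with
`s² ≥ 1 - p²`: `θ(p) ≤ Σ_{γ ∈ SAW_n} pⁿ (1-p)^{#chordEdges γ} s^{gapTotal γ} ((1+s)/2)^{cornerTotal γ}`.
[folklore] -/
theorem theta_le_sum_chordRandWeight (d n : ℕ) (p : unitInterval) {s : ℝ} (hs0 : 0 ≤ s) (hs1 : s ≤ 1)
    (hps : 1 - (p : ℝ) ^ 2 ≤ s ^ 2) :
    theta (zdGraph d) 0 p ≤ ∑ γ ∈ sawWords d n, chordRandWeight p s γ := by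
  classical
  have ho := fun o : Orders d n => theta_le_sum_of_orders p o hs0 hs1 hps
  have hO : (0 : ℝ) < Fintype.card (Orders d n) := Nat.cast_pos.2 Fintype.card_pos
  have hsum := sum_le_sum fun (o : Orders d n) (_ : o ∈ univ) => ho o
  rw [sum_const, card_univ, nsmul_eq_mul, sum_comm] at hsum
  have key : ∑ γ ∈ sawWords d n, ∑ o : Orders d n,
      (p : ℝ) ^ n * (1 - p : ℝ) ^ (chordEdges γ).card * s ^ gapTotal γ * s ^ (badTimes o γ).card
      = Fintype.card (Orders d n) * ∑ γ ∈ sawWords d n, chordRandWeight p s γ := by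
    rw [mul_sum]
    refine sum_congr rfl fun γ _ => ?_
    rw [← mul_sum, sum_orders_pow_card_badTimes, chordRandWeight]
    ring
  rw [key] at hsum
  exact le_of_mul_le_mul_left hsum hO

/-! ### Certificate glue -/

/-- **Certificate glue (B3r).** If `Σ_{γ ∈ SAW_n} chordRandWeight p s γ ≤ C rⁿ` for all `n` with `r < 1`, then
`θ(p) = 0`. [folklore] -/
theorem theta_zd_eq_zero_of_chordRand_le_geometric (d : ℕ) (p : unitInterval) {s C r : ℝ}
    (hs0 : 0 ≤ s) (hs1 : s ≤ 1) (hps : 1 - (p : ℝ) ^ 2 ≤ s ^ 2) (hr0 : 0 ≤ r) (hr : r < 1)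
    (h : ∀ n, ∑ γ ∈ sawWords d n, chordRandWeight p s γ ≤ C * r ^ n) : theta (zdGraph d) 0 p = 0 := by
  have ht : Filter.Tendsto (fun n : ℕ => C * r ^ n) Filter.atTop (nhds 0) := by
    simpa using (tendsto_pow_atTop_nhds_zero_of_lt_one hr0 hr).const_mul C
  exact le_antisymm (ge_of_tendsto' ht fun n => (theta_le_sum_chordRandWeight d n p hs0 hs1 hps).trans (h n))
    measureReal_nonneg

/-- **Certificate glue (B3r), threshold form**: under the same hypothesis, `p ≤ p_c^bond(ℤ^d)`. [folklore] -/
theorem le_criticalProb_zd_of_chordRand_le_geometric (d : ℕ) (p : unitInterval) {s C r : ℝ}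
    (hs0 : 0 ≤ s) (hs1 : s ≤ 1) (hps : 1 - (p : ℝ) ^ 2 ≤ s ^ 2) (hr0 : 0 ≤ r) (hr : r < 1)
    (h : ∀ n, ∑ γ ∈ sawWords d n, chordRandWeight p s γ ≤ C * r ^ n) :
    (p : ℝ) ≤ criticalProb (zdGraph d) 0 := by
  have h0 := theta_zd_eq_zero_of_chordRand_le_geometric d p hs0 hs1 hps hr0 hr h
  refine le_csInf ⟨1, Or.inr rfl⟩ ?_
  rintro q (⟨hq, hpos⟩ | hq)
  · by_contra hlt
    push Not at hlt
    have hmono := theta_mono_holds (zdGraph d) (0 : Site d) (show (⟨q, hq⟩ : unitInterval) ≤ p from hlt.le)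
    have : theta (zdGraph d) 0 ⟨q, hq⟩ ≤ 0 := hmono.trans_eq h0
    exact hpos.not_ge this
  · rw [Set.mem_singleton_iff] at hq
    rw [hq]
    exact p.2.2

end Summit.CriticalPhenomena.PercolationContinuityZ3.Theorems.Pcint
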